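import Literature.NumberTheory.Automorphic.SatakeIsomorphismModP
import HarnessLib

/-!
# The Satake isomorphism for `GL_n` in every normalisation: the counting transform `CT^{cl}` after inverting `q`,
# and the unitarily normalised transform `δ^{1/2} CT^{cl}` over any ring with a unit square root of `q`
# (Zhu 2020 §1.4, the two displays after Prop. 9; Gross 1998 §3; Cartier 1979 Thm. 4.1)

Topic `NumberTheory/Automorphic`; namespace `Literature.NumberTheory.Automorphic` (lane `lit-hodgefound`, Track 2
foundations; seat `lit-hodgefound-p11`, generation 43, row g43-#2).  THEOREMS ONLY: no definition, no named fact, no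
instance, no notation.  Setting: `F` with a `ValuativeRel` whose valuation ring is a DVR with finite residue field of
cardinality `q`, uniformizer `ϖ`, `K = GL_n(𝒪)`, `ℋ_R = heckeAlgebra R (GL (Fin n) F) (glInt n F)` over a commutative ring
`R`; the abstract transforms `𝒮_w = (isIwasawaExponent_gl hϖ).satakeTransform w` (`SatakeTransformIwasawa`) for a weight
`w : Multiplicative ℤⁿ →* R`: `w = 1` is the COUNTING transform `CT^{cl}` (Zhu; Herzig; Treumann–Venkatesh's `𝒮^*`),
`w = q^{-⟨ν, ·⟩}` (`ν = (n-1, …, 0)`, `q ∈ Rˣ`) is the INTEGRAL normalisation `𝒮_R = satakeTransformModP`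
(`SatakeTransformModP`, `= |det|^{(n-1)/2} 𝒮`), and `w = u^{-⟨2ρ, ·⟩} = u^{(n-1)|·| - 2⟨ν, ·⟩}` (`u² = q`, `u ∈ Rˣ`) is the
UNITARY normalisation `𝒮 = δ^{1/2} CT^{cl}` of Satake / Cartier / Gross.  The tree has the isomorphism
`𝒮_R : ℋ_R ≅ R[ℤⁿ]^{S_n}` for `q ∈ Rˣ` (g42-#6 `range_satakeTransformModP_eq_weylInvariants`); this file transports it to
the other two normalisations through monomial twists (`monomialTwist`, `𝒮_w = monomialTwist w ∘ 𝒮_1`):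

* §1 `coeff_monomialTwist` (`(monomialTwist w f)_l = w(l) f_l`), `monomialTwist_injective_of_isUnit`,
  `monomialTwist_monomialTwist_of_mul_eq_one` (inverse twists), `exists_monoidHom_apply_ofAdd_eq_units_zpow` (the
  characters `u^{φ(·)}`), **`monomialTwist_mem_weylInvariants`** / `mem_weylInvariants_of_monomialTwist_mem` (a twist by an
  `S_n`-INVARIANT character, e.g. `x^e ↦ c^{|e|} x^e`, preserves and reflects `R[ℤⁿ]^{S_n}`).
* §2 (`q ∈ Rˣ`) `satakeTransformModP_eq_monomialTwist_satakeTransform_one` (`𝒮_R = monomialTwist (q^{-⟨ν,·⟩}) ∘ CT^{cl}`),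
  **`mem_range_satakeTransform_one_iff_monomialTwist_mem_weylInvariants`** (`f ∈ CT^{cl}(ℋ_R)` iff its `q^{-⟨ν,·⟩}`-twist is
  `S_n`-invariant — Zhu's «`H_G ⊗ ℤ[q⁻¹] ≅ ℤ[q⁻¹][ᶜG|_{d=(q,σ)}]^{Ĝ}`» for `GL_n`), `range_satakeTransform_one_eq_comap_weylInvariants`,
  `map_monomialTwist_range_satakeTransform_one_eq_weylInvariants`.
* §3 (`u² = q`, `u ∈ Rˣ`) `sub_two_mul_satakeTwistExp_eq` (`(n-1)|e| - 2⟨ν, e⟩ = -⟨2ρ, e⟩`, `2ρ = (n-1, n-3, …, 1-n)`),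
  `zpow_deltaHalfExp_eq` (`u^{-⟨2ρ,e⟩} = u^{(n-1)|e|} (u²)^{-⟨ν,e⟩}`),
  **`satakeTransform_deltaHalf_eq_monomialTwist_satakeTransformModP`** (`δ^{1/2} CT^{cl} = monomialTwist (u^{(n-1)|·|}) ∘ 𝒮_R`:
  Zhu, «`CT^{cl}` differs from the usual Satake transform by a square root of the modular character»),
  **`range_satakeTransform_deltaHalf_eq_weylInvariants`** (THE USUAL SATAKE ISOMORPHISM over any `R` with `√q ∈ Rˣ`:
  `δ^{1/2}CT^{cl}(ℋ_R) = R[ℤⁿ]^{S_n}`; Zhu's «`H_G ⊗ ℤ[q^{±1/2}] ≅ ℤ[q^{±1/2}][Ĝσ]^{Ĝ}`», Gross §3, Cartier Thm. 4.1),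
  `bijective_codRestrict_satakeTransform_deltaHalf`, `exists_algEquiv_satakeTransform_deltaHalf_weylInvariants`.

## The print

[ZhuIntegralSatake2020] §1.4, after Prop. 9 (arXiv p. 7): «the above isomorphism induces a canonical isomorphism
`H_G ⊗ ℤ[q⁻¹] ≅ ℤ[q⁻¹][ᶜG|_{d_{ρ_ad}=(q,σ)}]^{Ĝ}`.  After choosing a square root `q^{1/2}` […] The composition of
`CT^{cl}` with the bottom map [`e^{λ̂} ↦ (q^{-1/2})^{(2ρ, λ̂)} e^{λ̂}`] is the usual Satake transform.  We thus obtain the usual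
classical Satake isomorphism `H_G ⊗ ℤ[q^{±1/2}] ≅ ℤ[q^{±1/2}][Ĝσ]^{Ĝ}`»; for `G = GL_n` (split, `σ = 1`) the right-hand
sides restrict on `T̂` to the symmetric Laurent polynomials `R[ℤⁿ]^{S_n}`.  [GrossSatake1998] §3 (the Satake isomorphism is
defined over `ℤ[q^{1/2}, q^{-1/2}]`; over `ℤ[q⁻¹]` after twisting by `|det|^{(n-1)/2}`).  [CartierCorvallis1979] §IV (4.2)
`Sf(m) = δ(m)^{1/2} ∫_N f(mn) dn`, Thm. 4.1 «The Satake transform is an isomorphism of `H(G, K)` onto `ℂ[X_*(A)]^W`».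
Here `δ_B(ϖ^e)^{1/2} = u^{-⟨2ρ, e⟩}`, `⟨2ρ, e⟩ = ∑_i (n-1-2i) e_i = 2⟨ν, e⟩ - (n-1)|e|` (upper-triangular `B`).

## References
* [ZhuIntegralSatake2020] X. Zhu, *A note on integral Satake isomorphisms*, arXiv:2005.13056, §1.4 (p. 7).
* [GrossSatake1998] B. H. Gross, *On the Satake isomorphism* (1998), §3.
* [CartierCorvallis1979] P. Cartier, *Representations of 𝔭-adic groups: a survey*, PSPM 33.1 (1979), §IV (4.2), Thm. 4.1.
* [TreumannVenkatesh2016] D. Treumann, A. Venkatesh, Ann. of Math. 183 (2016), §7.2 Theorem (i).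
* [BruhatTits1972] F. Bruhat, J. Tits, Publ. Math. IHÉS 41 (1972), Prop. (4.4.4) (injectivity over any `R`, g42-#1).
-/

noncomputable section

open scoped MatrixGroups Pointwise
open ValuativeRel Matrix Finset MonoidAlgebra Representation MulAction

namespace Literature.NumberTheory.Automorphic

/-! ## §1 Monomial twists: coefficients, injectivity, inverses, and twists by `S_n`-invariant characters -/

section Twist

variable {Λ : Type*} [AddCommGroup Λ] {R : Type*} [CommRing R]

/-- **Coefficients of a monomial twist**: `(monomialTwist w f)_l = w(l) f_l`. [cite: CartierCorvallis1979, §IV (4.2)] -/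
theorem coeff_monomialTwist (w : Multiplicative Λ →* R) (f : AddMonoidAlgebra R Λ) (l : Λ) :
    (monomialTwist w f).coeff l = w (Multiplicative.ofAdd l) * f.coeff l := by
  classical
  induction f using AddMonoidAlgebra.induction_on with
  | hM m =>
    rw [AddMonoidAlgebra.of_apply, toAdd_ofAdd, monomialTwist_single, one_mul, AddMonoidAlgebra.coeff_single,
      AddMonoidAlgebra.coeff_single, Finsupp.single_apply, Finsupp.single_apply]
    by_cases h : m = l
    · subst h; rw [if_pos rfl, if_pos rfl, mul_one]
    · rw [if_neg h, if_neg h, mul_zero]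
  | hadd x y hx hy =>
    rw [map_add, AddMonoidAlgebra.coeff_add, Finsupp.add_apply, AddMonoidAlgebra.coeff_add, Finsupp.add_apply, hx, hy,
      mul_add]
  | hsmul r x hx =>
    rw [map_smul, AddMonoidAlgebra.coeff_smul, Finsupp.smul_apply, AddMonoidAlgebra.coeff_smul, Finsupp.smul_apply, hx,
      smul_eq_mul, smul_eq_mul, mul_left_comm]

/-- A monomial twist by a UNIT-valued character is injective. [cite: CartierCorvallis1979, §IV (4.2)] -/
theorem monomialTwist_injective_of_isUnit (w : Multiplicative Λ →* R) (hw : ∀ l, IsUnit (w l)) :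
    Function.Injective (monomialTwist w) := by
  intro f g h
  refine AddMonoidAlgebra.ext (Finsupp.ext fun l => ?_)
  have hl := congrArg (fun x : AddMonoidAlgebra R Λ => x.coeff l) h
  simp only [coeff_monomialTwist] at hl
  exact (hw _).mul_left_cancel hl

/-- Twists by `w` and by a pointwise inverse `w'` of `w` are mutually inverse: `monomialTwist w (monomialTwist w' f) = f`.
[cite: CartierCorvallis1979, §IV (4.2)] -/
theorem monomialTwist_monomialTwist_of_mul_eq_one (w w' : Multiplicative Λ →* R) (h : ∀ l, w l * w' l = 1)
    (f : AddMonoidAlgebra R Λ) : monomialTwist w (monomialTwist w' f) = f := by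
  have hcomp : (monomialTwist w).comp (monomialTwist w') = AlgHom.id R (AddMonoidAlgebra R Λ) := by
    rw [monomialTwist_comp, ← monomialTwist_one]
    congr 1
    exact MonoidHom.ext fun l => by rw [MonoidHom.mul_apply, h, MonoidHom.one_apply]
  have := congrArg (fun φ : AddMonoidAlgebra R Λ →ₐ[R] AddMonoidAlgebra R Λ => φ f) hcomp
  simpa only [AlgHom.comp_apply, AlgHom.id_apply] using this

/-- Characters given by a unit power of an additive functional: `e ↦ u^{φ(e)}` is (the value at `ofAdd e` of) a
homomorphism `Multiplicative Λ →* R`. [cite: CartierCorvallis1979, §IV (4.2)] -/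
theorem exists_monoidHom_apply_ofAdd_eq_units_zpow (u : Rˣ) (φ : Λ →+ ℤ) :
    ∃ w : Multiplicative Λ →* R, ∀ e : Λ, w (Multiplicative.ofAdd e) = ((u ^ φ e : Rˣ) : R) :=
  ⟨(Units.coeHom R).comp ((zpowersHom Rˣ u).comp (AddMonoidHom.toMultiplicative φ)), fun _ => rfl⟩

end Twist

section WeylTwist

variable {n : ℕ} {R : Type*} [CommRing R]

/-- **A monomial twist by an `S_n`-INVARIANT character preserves `R[ℤⁿ]^{S_n}`** (e.g. `x^e ↦ c^{|e|} x^e`, the unramified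
determinant twist). [cite: CartierCorvallis1979, §IV.2 Example] [cite: GrossSatake1998, §3] -/
theorem monomialTwist_mem_weylInvariants (c : Multiplicative (Fin n → ℤ) →* R)
    (hc : ∀ (e : Fin n → ℤ) (σ : Equiv.Perm (Fin n)), c (Multiplicative.ofAdd (e ∘ σ)) = c (Multiplicative.ofAdd e))
    {f : AddMonoidAlgebra R (Fin n → ℤ)} (hf : f ∈ weylInvariants R (Fin n → ℤ) (ConnectedReductiveGroupData.glWeylGroup n)) :
    monomialTwist c f ∈ weylInvariants R (Fin n → ℤ) (ConnectedReductiveGroupData.glWeylGroup n) := by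
  rw [mem_weylInvariants_glWeylGroup_iff] at hf ⊢
  intro σ
  rw [domCongr_eq_self_iff_coeff]
  intro e
  have h := (domCongr_eq_self_iff_coeff _ _).1 (hf σ) e
  rw [SymmLaurent.funCongrLeft_toAddEquiv_apply] at h ⊢
  rw [coeff_monomialTwist, coeff_monomialTwist, h, hc]

/-- Conversely, for a UNIT-valued `S_n`-invariant character, `monomialTwist c f ∈ R[ℤⁿ]^{S_n}` forces `f ∈ R[ℤⁿ]^{S_n}`.
[cite: CartierCorvallis1979, §IV.2 Example] [cite: GrossSatake1998, §3] -/
theorem mem_weylInvariants_of_monomialTwist_mem (c : Multiplicative (Fin n → ℤ) →* R) (hcu : ∀ l, IsUnit (c l))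
    (hc : ∀ (e : Fin n → ℤ) (σ : Equiv.Perm (Fin n)), c (Multiplicative.ofAdd (e ∘ σ)) = c (Multiplicative.ofAdd e))
    {f : AddMonoidAlgebra R (Fin n → ℤ)}
    (hf : monomialTwist c f ∈ weylInvariants R (Fin n → ℤ) (ConnectedReductiveGroupData.glWeylGroup n)) :
    f ∈ weylInvariants R (Fin n → ℤ) (ConnectedReductiveGroupData.glWeylGroup n) := by
  rw [mem_weylInvariants_glWeylGroup_iff] at hf ⊢
  intro σ
  rw [domCongr_eq_self_iff_coeff]
  intro e
  have h := (domCongr_eq_self_iff_coeff _ _).1 (hf σ) e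
  rw [SymmLaurent.funCongrLeft_toAddEquiv_apply] at h ⊢
  rw [coeff_monomialTwist, coeff_monomialTwist, hc] at h
  exact (hcu _).mul_left_cancel h

end WeylTwist

/-! ## §2 `q ∈ Rˣ`: the image of the counting transform `𝒮_1 = CT^{cl}` is the `q^{-⟨ν, ·⟩}`-untwist of `R[ℤⁿ]^{S_n}` -/

section Invertible

variable {F : Type*} [Field F] [ValuativeRel F] {n : ℕ} [IsDiscreteValuationRing 𝒪[F]] [Finite 𝓀[F]] {ϖ : F}
  [IsHeckeTriple (⊤ : Submonoid (GL (Fin n) F)) (glInt n F) (glInt n F)] {R : Type*} [CommRing R]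

omit [Finite 𝓀[F]] [IsHeckeTriple (⊤ : Submonoid (GL (Fin n) F)) (glInt n F) (glInt n F)] in
/-- **`𝒮_R = monomialTwist (q^{-⟨ν, ·⟩}) ∘ 𝒮_1`**: the Satake transform with coefficients in `R` (`q ∈ Rˣ`,
`SatakeTransformModP`) is the `q^{-⟨ν, ·⟩}`-twist of the counting transform `𝒮_1 = CT^{cl}`.
[cite: ZhuIntegralSatake2020, §1.4 (after Prop. 9)] [cite: CartierCorvallis1979, §IV (4.2)] -/
theorem satakeTransformModP_eq_monomialTwist_satakeTransform_one (hϖ : IsUniformizingElement ϖ)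
    (hq : IsUnit ((Nat.card 𝓀[F] : ℕ) : R)) {w : Multiplicative (Fin n → ℤ) →* R}
    (hw : ∀ e : Fin n → ℤ, w (Multiplicative.ofAdd e) = ((satakeWeightUnit hq.unit e : Rˣ) : R))
    (T : heckeAlgebra R (GL (Fin n) F) (glInt n F)) :
    satakeTransformModP hϖ hq T =
      monomialTwist w ((isIwasawaExponent_gl hϖ).satakeTransform (1 : Multiplicative (Fin n → ℤ) →* R) T) := by
  rw [satakeTransformModP_eq_isIwasawaExponent_satakeTransform hϖ hq hw,
    (isIwasawaExponent_gl hϖ).satakeTransform_eq_monomialTwist_comp w, AlgHom.comp_apply]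

/-- **THE INTEGRAL IMAGE AFTER INVERTING `q`** (Zhu: «`H_G ⊗ ℤ[q⁻¹] ≅ ℤ[q⁻¹][ᶜG|_{d=(q,σ)}]^{Ĝ}`», for `GL_n`: after the
twist `e^μ ↦ q^{-⟨ν, μ⟩} e^μ` the twisted-invariant image of `CT^{cl}` becomes the honest `S_n`-invariants): for `q ∈ Rˣ`,
`f ∈ 𝒮_1(ℋ_R)` iff `monomialTwist (q^{-⟨ν, ·⟩}) f ∈ R[ℤⁿ]^{S_n}`.  (`𝒮_R(ℋ_R) = R[ℤⁿ]^{S_n}` is g42-#6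
`range_satakeTransformModP_eq_weylInvariants`.) [cite: ZhuIntegralSatake2020, §1.4 (after Prop. 9)]
[cite: TreumannVenkatesh2016, §7.2 Theorem (i)] -/
theorem mem_range_satakeTransform_one_iff_monomialTwist_mem_weylInvariants (hϖ : IsUniformizingElement ϖ)
    (hq : IsUnit ((Nat.card 𝓀[F] : ℕ) : R)) {w : Multiplicative (Fin n → ℤ) →* R}
    (hw : ∀ e : Fin n → ℤ, w (Multiplicative.ofAdd e) = ((satakeWeightUnit hq.unit e : Rˣ) : R))
    (f : AddMonoidAlgebra R (Fin n → ℤ)) :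
    f ∈ ((isIwasawaExponent_gl hϖ).satakeTransform (1 : Multiplicative (Fin n → ℤ) →* R)).range ↔
      monomialTwist w f ∈ weylInvariants R (Fin n → ℤ) (ConnectedReductiveGroupData.glWeylGroup n) := by
  constructor
  · rintro ⟨T, rfl⟩
    have h := satakeTransformModP_mem_weylInvariants hϖ hq T
    rwa [satakeTransformModP_eq_monomialTwist_satakeTransform_one hϖ hq hw] at h
  · intro hf
    have hT' := mem_range_satakeTransformModP_of_mem_weylInvariants hϖ hq hf
    rw [AlgHom.mem_range] at hT'
    obtain ⟨T, hT⟩ := hT'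
    rw [satakeTransformModP_eq_monomialTwist_satakeTransform_one hϖ hq hw] at hT
    have hwu : ∀ l : Multiplicative (Fin n → ℤ), IsUnit (w l) := fun l => by
      rw [← ofAdd_toAdd l, hw]
      exact Units.isUnit _
    exact ⟨T, monomialTwist_injective_of_isUnit w hwu hT⟩

/-- The same, as an equality of subalgebras: `𝒮_1(ℋ_R) = (monomialTwist q^{-⟨ν,·⟩})⁻¹ (R[ℤⁿ]^{S_n})` for `q ∈ Rˣ`.
[cite: ZhuIntegralSatake2020, §1.4 (after Prop. 9)] [cite: TreumannVenkatesh2016, §7.2 Theorem (i)] -/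
theorem range_satakeTransform_one_eq_comap_weylInvariants (hϖ : IsUniformizingElement ϖ)
    (hq : IsUnit ((Nat.card 𝓀[F] : ℕ) : R)) {w : Multiplicative (Fin n → ℤ) →* R}
    (hw : ∀ e : Fin n → ℤ, w (Multiplicative.ofAdd e) = ((satakeWeightUnit hq.unit e : Rˣ) : R)) :
    ((isIwasawaExponent_gl hϖ).satakeTransform (1 : Multiplicative (Fin n → ℤ) →* R)).range =
      (weylInvariants R (Fin n → ℤ) (ConnectedReductiveGroupData.glWeylGroup n)).comap (monomialTwist w) := by
  ext f
  rw [Subalgebra.mem_comap]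
  exact mem_range_satakeTransform_one_iff_monomialTwist_mem_weylInvariants hϖ hq hw f

/-- And as an equality of images: `monomialTwist (q^{-⟨ν,·⟩}) (𝒮_1(ℋ_R)) = R[ℤⁿ]^{S_n}` (`q ∈ Rˣ`).
[cite: ZhuIntegralSatake2020, §1.4 (after Prop. 9)] [cite: TreumannVenkatesh2016, §7.2 Theorem (i)] -/
theorem map_monomialTwist_range_satakeTransform_one_eq_weylInvariants (hϖ : IsUniformizingElement ϖ)
    (hq : IsUnit ((Nat.card 𝓀[F] : ℕ) : R)) {w : Multiplicative (Fin n → ℤ) →* R}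
    (hw : ∀ e : Fin n → ℤ, w (Multiplicative.ofAdd e) = ((satakeWeightUnit hq.unit e : Rˣ) : R)) :
    ((isIwasawaExponent_gl hϖ).satakeTransform (1 : Multiplicative (Fin n → ℤ) →* R)).range.map (monomialTwist w) =
      weylInvariants R (Fin n → ℤ) (ConnectedReductiveGroupData.glWeylGroup n) := by
  rw [← AlgHom.range_comp, ← (isIwasawaExponent_gl hϖ).satakeTransform_eq_monomialTwist_comp w,
    ← satakeTransformModP_eq_isIwasawaExponent_satakeTransform hϖ hq hw, range_satakeTransformModP_eq_weylInvariants hϖ hq]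

end Invertible

/-! ## §3 `q = u²`, `u ∈ Rˣ`: the unitarily normalised transform `𝒮 = δ^{1/2} CT^{cl}` is an isomorphism onto `R[ℤⁿ]^{S_n}` -/

section HalfIntegral

variable {F : Type*} [Field F] [ValuativeRel F] {n : ℕ} [IsDiscreteValuationRing 𝒪[F]] [Finite 𝓀[F]] {ϖ : F}
  [IsHeckeTriple (⊤ : Submonoid (GL (Fin n) F)) (glInt n F) (glInt n F)] {R : Type*} [CommRing R]

/-- The unitary weight exponent `-2⟨ρ, e⟩ = (n-1)|e| - 2⟨ν, e⟩` (`2ρ = (n-1, n-3, …, 1-n)`, `ν = (n-1, …, 1, 0)`):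
`(n-1)|e| - 2⟨ν, e⟩ = -∑_i (n-1-2i) e_i`. [cite: CartierCorvallis1979, §IV (4.2)] [cite: GrossSatake1998, §3] -/
theorem sub_two_mul_satakeTwistExp_eq (e : Fin n → ℤ) :
    ((n : ℤ) - 1) * (∑ i, e i) - 2 * satakeTwistExp e = -∑ i : Fin n, ((n : ℤ) - 1 - 2 * (i : ℕ)) * e i := by
  rw [satakeTwistExp, Finset.mul_sum, Finset.mul_sum, ← Finset.sum_sub_distrib, ← Finset.sum_neg_distrib]
  refine Finset.sum_congr rfl fun i _ => ?_
  ring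

/-- The unitary weight `e ↦ u^{-2⟨ρ, e⟩} = u^{(n-1)|e| - 2⟨ν, e⟩} = δ_B(ϖ^e)^{1/2}` (`u = q^{1/2}`) exists as a homomorphism
`Multiplicative ℤⁿ →* R`. [cite: CartierCorvallis1979, §IV (4.2)] [cite: GrossSatake1998, §3] -/
theorem exists_monoidHom_apply_ofAdd_eq_zpow_deltaHalfExp (u : Rˣ) :
    ∃ w : Multiplicative (Fin n → ℤ) →* R, ∀ e : Fin n → ℤ,
      w (Multiplicative.ofAdd e) = ((u ^ (((n : ℤ) - 1) * (∑ i, e i) - 2 * satakeTwistExp e) : Rˣ) : R) :=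
  exists_monoidHom_apply_ofAdd_eq_units_zpow u
    (AddMonoidHom.mk' (fun e : Fin n → ℤ => ((n : ℤ) - 1) * (∑ i, e i) - 2 * satakeTwistExp e) fun a b => by
      simp only [Pi.add_apply, Finset.sum_add_distrib, satakeTwistExp_add]
      ring)

omit [Finite 𝓀[F]] [IsHeckeTriple (⊤ : Submonoid (GL (Fin n) F)) (glInt n F) (glInt n F)] in
/-- If `u² = q` in `R` with `u` a unit, then `q` is a unit. [cite: GrossSatake1998, §3] -/
theorem isUnit_natCard_of_sq_eq {u : Rˣ} (hu : (u : R) ^ 2 = ((Nat.card 𝓀[F] : ℕ) : R)) :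
    IsUnit ((Nat.card 𝓀[F] : ℕ) : R) :=
  hu ▸ (Units.isUnit u).pow 2

omit [Finite 𝓀[F]] [IsHeckeTriple (⊤ : Submonoid (GL (Fin n) F)) (glInt n F) (glInt n F)] in
/-- The unit `hq.unit` of `q = u²` is `u²`. [cite: GrossSatake1998, §3] -/
theorem unit_eq_sq_of_sq_eq {u : Rˣ} (hu : (u : R) ^ 2 = ((Nat.card 𝓀[F] : ℕ) : R))
    (hq : IsUnit ((Nat.card 𝓀[F] : ℕ) : R)) : hq.unit = u ^ 2 :=
  Units.ext (by rw [IsUnit.unit_spec, Units.val_pow_eq_pow_val, hu])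

/-- **The unitary weight is the determinant twist of the integral weight**:
`u^{(n-1)|e| - 2⟨ν, e⟩} = u^{(n-1)|e|} · (u²)^{-⟨ν, e⟩}`. [cite: GrossSatake1998, §3] [cite: ZhuIntegralSatake2020, §1.4 (after Prop. 9)] -/
theorem zpow_deltaHalfExp_eq (u : Rˣ) (e : Fin n → ℤ) :
    u ^ (((n : ℤ) - 1) * (∑ i, e i) - 2 * satakeTwistExp e) = u ^ (((n : ℤ) - 1) * ∑ i, e i) * satakeWeightUnit (u ^ 2) e := by
  rw [satakeWeightUnit, ← zpow_natCast, ← _root_.zpow_mul, ← _root_.zpow_add]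
  congr 1
  push_cast
  ring

omit [Finite 𝓀[F]] [IsHeckeTriple (⊤ : Submonoid (GL (Fin n) F)) (glInt n F) (glInt n F)] in
/-- **The unitarily normalised Satake transform `𝒮 = δ^{1/2} · CT^{cl}` is the unramified determinant twist of the
integral one**: `𝒮_{u^{-2ρ}} = monomialTwist (u^{(n-1)|·|}) ∘ 𝒮_R` (`𝒮_R` = `satakeTransformModP` with `q = u²`; Zhu:
`CT^{cl}` «differs from the usual Satake transform by a square root of the modular character»; `SatakeTransformModP`:
`𝒮_ν = |det|^{(n-1)/2} 𝒮`). [cite: ZhuIntegralSatake2020, §1.4 Prop. 9, proof] [cite: GrossSatake1998, §3]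
[cite: CartierCorvallis1979, §IV (4.2)] -/
theorem satakeTransform_deltaHalf_eq_monomialTwist_satakeTransformModP (hϖ : IsUniformizingElement ϖ) {u : Rˣ}
    (hu : (u : R) ^ 2 = ((Nat.card 𝓀[F] : ℕ) : R)) {w : Multiplicative (Fin n → ℤ) →* R}
    (hw : ∀ e : Fin n → ℤ,
      w (Multiplicative.ofAdd e) = ((u ^ (((n : ℤ) - 1) * (∑ i, e i) - 2 * satakeTwistExp e) : Rˣ) : R))
    {c : Multiplicative (Fin n → ℤ) →* R}
    (hc : ∀ e : Fin n → ℤ, c (Multiplicative.ofAdd e) = ((u ^ (((n : ℤ) - 1) * ∑ i, e i) : Rˣ) : R))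
    (T : heckeAlgebra R (GL (Fin n) F) (glInt n F)) :
    (isIwasawaExponent_gl hϖ).satakeTransform w T =
      monomialTwist c (satakeTransformModP hϖ (isUnit_natCard_of_sq_eq hu) T) := by
  obtain ⟨wν, hwν⟩ := exists_monoidHom_apply_ofAdd_eq_satakeWeightUnit (n := n) (isUnit_natCard_of_sq_eq (F := F) hu).unit
  have hwc : w = c * wν := by
    refine MonoidHom.ext fun l => ?_
    rw [← ofAdd_toAdd l, MonoidHom.mul_apply, hw, hc, hwν, unit_eq_sq_of_sq_eq hu, ← Units.val_mul, zpow_deltaHalfExp_eq]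
  rw [satakeTransformModP_eq_monomialTwist_satakeTransform_one hϖ _ hwν,
    (isIwasawaExponent_gl hϖ).satakeTransform_eq_monomialTwist_comp w, AlgHom.comp_apply, hwc, ← monomialTwist_comp,
    AlgHom.comp_apply]

/-- The determinant-twist character `e ↦ u^{(n-1)|e|}` exists as a homomorphism. [cite: GrossSatake1998, §3] -/
theorem exists_monoidHom_apply_ofAdd_eq_zpow_sum (u : Rˣ) :
    ∃ c : Multiplicative (Fin n → ℤ) →* R,
      ∀ e : Fin n → ℤ, c (Multiplicative.ofAdd e) = ((u ^ (((n : ℤ) - 1) * ∑ i, e i) : Rˣ) : R) :=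
  exists_monoidHom_apply_ofAdd_eq_units_zpow u
    (AddMonoidHom.mk' (fun e : Fin n → ℤ => ((n : ℤ) - 1) * ∑ i, e i) fun a b => by
      simp only [Pi.add_apply, Finset.sum_add_distrib, mul_add])

/-- The determinant-twist character is `S_n`-invariant (`|e ∘ σ| = |e|`). [cite: GrossSatake1998, §3] -/
theorem apply_ofAdd_comp_perm_eq_of_eq_zpow_sum {u : Rˣ} {c : Multiplicative (Fin n → ℤ) →* R}
    (hc : ∀ e : Fin n → ℤ, c (Multiplicative.ofAdd e) = ((u ^ (((n : ℤ) - 1) * ∑ i, e i) : Rˣ) : R))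
    (e : Fin n → ℤ) (σ : Equiv.Perm (Fin n)) :
    c (Multiplicative.ofAdd (e ∘ σ)) = c (Multiplicative.ofAdd e) := by
  rw [hc, hc, show (∑ i, (e ∘ σ) i) = ∑ i, e i from Equiv.sum_comp σ e]

/-- **THE SATAKE TRANSFORM IN THE UNITARY NORMALISATION TAKES VALUES IN `R[ℤⁿ]^{S_n}`** (`u² = q`, `u ∈ Rˣ`).
[cite: CartierCorvallis1979, §IV Thm. 4.1] [cite: GrossSatake1998, §3] -/
theorem satakeTransform_deltaHalf_mem_weylInvariants (hϖ : IsUniformizingElement ϖ) {u : Rˣ}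
    (hu : (u : R) ^ 2 = ((Nat.card 𝓀[F] : ℕ) : R)) {w : Multiplicative (Fin n → ℤ) →* R}
    (hw : ∀ e : Fin n → ℤ,
      w (Multiplicative.ofAdd e) = ((u ^ (((n : ℤ) - 1) * (∑ i, e i) - 2 * satakeTwistExp e) : Rˣ) : R))
    (T : heckeAlgebra R (GL (Fin n) F) (glInt n F)) :
    (isIwasawaExponent_gl hϖ).satakeTransform w T ∈ weylInvariants R (Fin n → ℤ) (ConnectedReductiveGroupData.glWeylGroup n) := by
  obtain ⟨c, hc⟩ := exists_monoidHom_apply_ofAdd_eq_zpow_sum (n := n) u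
  rw [satakeTransform_deltaHalf_eq_monomialTwist_satakeTransformModP hϖ hu hw hc]
  exact monomialTwist_mem_weylInvariants c (apply_ofAdd_comp_perm_eq_of_eq_zpow_sum hc)
    (satakeTransformModP_mem_weylInvariants hϖ _ T)

/-- **EVERY `S_n`-INVARIANT IS A UNITARILY NORMALISED TRANSFORM** (`u² = q`, `u ∈ Rˣ`): untwist by `u^{-(n-1)|·|}`, land in
`R[ℤⁿ]^{S_n} = 𝒮_R(ℋ_R)` (g42-#6), twist back. [cite: CartierCorvallis1979, §IV Thm. 4.1] [cite: GrossSatake1998, §3] -/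
theorem mem_range_satakeTransform_deltaHalf_of_mem_weylInvariants (hϖ : IsUniformizingElement ϖ) {u : Rˣ}
    (hu : (u : R) ^ 2 = ((Nat.card 𝓀[F] : ℕ) : R)) {w : Multiplicative (Fin n → ℤ) →* R}
    (hw : ∀ e : Fin n → ℤ,
      w (Multiplicative.ofAdd e) = ((u ^ (((n : ℤ) - 1) * (∑ i, e i) - 2 * satakeTwistExp e) : Rˣ) : R))
    {f : AddMonoidAlgebra R (Fin n → ℤ)} (hf : f ∈ weylInvariants R (Fin n → ℤ) (ConnectedReductiveGroupData.glWeylGroup n)) :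
    f ∈ ((isIwasawaExponent_gl hϖ).satakeTransform w).range := by
  obtain ⟨c, hc⟩ := exists_monoidHom_apply_ofAdd_eq_zpow_sum (n := n) u
  obtain ⟨c', hc'⟩ := exists_monoidHom_apply_ofAdd_eq_zpow_sum (n := n) u⁻¹
  have hcc' : ∀ l, c l * c' l = 1 := fun l => by
    rw [← ofAdd_toAdd l, hc, hc', ← Units.val_mul, ← _root_.mul_zpow, mul_inv_cancel, _root_.one_zpow, Units.val_one]
  have hc'c : ∀ l, c' l * c l = 1 := fun l => by rw [mul_comm, hcc']
  -- `monomialTwist c' f` is invariant, hence a transform `𝒮_R(T)`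
  have hf' := monomialTwist_mem_weylInvariants c' (apply_ofAdd_comp_perm_eq_of_eq_zpow_sum hc') hf
  have hT' := mem_range_satakeTransformModP_of_mem_weylInvariants hϖ (isUnit_natCard_of_sq_eq hu) hf'
  rw [AlgHom.mem_range] at hT'
  obtain ⟨T, hT⟩ := hT'
  refine ⟨T, ?_⟩
  change (isIwasawaExponent_gl hϖ).satakeTransform w T = f
  rw [satakeTransform_deltaHalf_eq_monomialTwist_satakeTransformModP hϖ hu hw hc, hT,
    monomialTwist_monomialTwist_of_mul_eq_one c c' hcc']

/-- **THE SATAKE ISOMORPHISM IN THE UNITARY NORMALISATION, OVER ANY COMMUTATIVE RING WITH A UNIT SQUARE ROOT `u` OF `q`**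
(Zhu: «the usual classical Satake isomorphism `H_G ⊗ ℤ[q^{±1/2}] ≅ ℤ[q^{±1/2}][Ĝσ]^{Ĝ}`»; Gross §3: the isomorphism
`ℋ ⊗ ℤ[q^{1/2}, q^{-1/2}] ≅ R(Ĝ) ⊗ ℤ[q^{1/2}, q^{-1/2}]`; Cartier Thm. 4.1 over `ℂ`): the image of
`𝒮 = δ^{1/2} CT^{cl} = 𝒮_{u^{-2ρ}}` is EXACTLY `R[ℤⁿ]^{S_n}`. [cite: ZhuIntegralSatake2020, §1.4 (after Prop. 9)]
[cite: GrossSatake1998, §3] [cite: CartierCorvallis1979, §IV Thm. 4.1] -/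
theorem range_satakeTransform_deltaHalf_eq_weylInvariants (hϖ : IsUniformizingElement ϖ) {u : Rˣ}
    (hu : (u : R) ^ 2 = ((Nat.card 𝓀[F] : ℕ) : R)) {w : Multiplicative (Fin n → ℤ) →* R}
    (hw : ∀ e : Fin n → ℤ,
      w (Multiplicative.ofAdd e) = ((u ^ (((n : ℤ) - 1) * (∑ i, e i) - 2 * satakeTwistExp e) : Rˣ) : R)) :
    ((isIwasawaExponent_gl hϖ).satakeTransform w).range =
      weylInvariants R (Fin n → ℤ) (ConnectedReductiveGroupData.glWeylGroup n) :=
  le_antisymm (by rintro _ ⟨T, rfl⟩; exact satakeTransform_deltaHalf_mem_weylInvariants hϖ hu hw T)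
    fun _ hf => mem_range_satakeTransform_deltaHalf_of_mem_weylInvariants hϖ hu hw hf

/-- **`𝒮_{u^{-2ρ}}` is a bijection of `ℋ_R(GL_n(F), GL_n(𝒪))` onto `R[ℤⁿ]^{S_n}`** (injective over every `R` by g42-#1).
[cite: CartierCorvallis1979, §IV Thm. 4.1] [cite: GrossSatake1998, §3] [cite: BruhatTits1972, Prop. (4.4.4) (ii)] -/
theorem bijective_codRestrict_satakeTransform_deltaHalf (hϖ : IsUniformizingElement ϖ) {u : Rˣ}
    (hu : (u : R) ^ 2 = ((Nat.card 𝓀[F] : ℕ) : R)) {w : Multiplicative (Fin n → ℤ) →* R}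
    (hw : ∀ e : Fin n → ℤ,
      w (Multiplicative.ofAdd e) = ((u ^ (((n : ℤ) - 1) * (∑ i, e i) - 2 * satakeTwistExp e) : Rˣ) : R)) :
    Function.Bijective (((isIwasawaExponent_gl hϖ).satakeTransform w).codRestrict
      (weylInvariants R (Fin n → ℤ) (ConnectedReductiveGroupData.glWeylGroup n))
      (satakeTransform_deltaHalf_mem_weylInvariants hϖ hu hw)) := by
  refine ⟨fun S T h => satakeTransform_gl_injective_of_commRing hϖ w (congrArg Subtype.val h), fun f => ?_⟩
  obtain ⟨T, hT⟩ := mem_range_satakeTransform_deltaHalf_of_mem_weylInvariants hϖ hu hw f.2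
  exact ⟨T, Subtype.ext hT⟩

/-- **`ℋ_R(GL_n(F), GL_n(𝒪)) ≃ₐ[R] R[ℤⁿ]^{S_n}` through the unitarily normalised transform** (`u² = q`, `u ∈ Rˣ`).
[cite: CartierCorvallis1979, §IV Thm. 4.1] [cite: GrossSatake1998, §3] -/
theorem exists_algEquiv_satakeTransform_deltaHalf_weylInvariants (hϖ : IsUniformizingElement ϖ) {u : Rˣ}
    (hu : (u : R) ^ 2 = ((Nat.card 𝓀[F] : ℕ) : R)) {w : Multiplicative (Fin n → ℤ) →* R}
    (hw : ∀ e : Fin n → ℤ,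
      w (Multiplicative.ofAdd e) = ((u ^ (((n : ℤ) - 1) * (∑ i, e i) - 2 * satakeTwistExp e) : Rˣ) : R)) :
    ∃ e : heckeAlgebra R (GL (Fin n) F) (glInt n F) ≃ₐ[R]
        weylInvariants R (Fin n → ℤ) (ConnectedReductiveGroupData.glWeylGroup n),
      ∀ T, (e T : AddMonoidAlgebra R (Fin n → ℤ)) = (isIwasawaExponent_gl hϖ).satakeTransform w T :=
  ⟨AlgEquiv.ofBijective _ (bijective_codRestrict_satakeTransform_deltaHalf hϖ hu hw), fun _ => rfl⟩

end HalfIntegral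

end Literature.NumberTheory.Automorphic

end
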